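import Summits.FinalStateConjecture.FinalStateConjecture.Theses.ZeroEnergyKerrOrBomb
import Summits.FinalStateConjecture.FinalStateConjecture.Theorems.ErgoregionBomb.Negative.TrappingClauseVacuous
import Literature.Geometry.Lorentzian.GeodesicProofs

/-!
# `ErgoregionBomb` (crux `stmt-FinalStateConjecture-10691`, route `ZeroEnergyKerrOrBomb`) —
# skeleton of line `Sketch` (lead prover), vacuity composition

The crux AS TYPED is vacuously true: its trapping clause `IsCompact K → … → ∀ s ≥ 0, γ s ∈ K`
imprisons an affinely parametrised null geodesic half-ray in a compact subset of spacetime, which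
contradicts `IsGloballyHyperbolic` on the telescope's carrier (Hausdorff, second countable,
boundaryless, `C^∞` metric) — `Negative.trapping_clause_contradictory` (landed, p73277) modulo
three facts: Bernal–Sánchez 2007 Thm 3.2 (tree theorem
`bernalSanchez_isStronglyCausal_of_isGloballyHyperbolic_holds`, landed 2026-08-16),
non-imprisonment (tree theorem `IsStronglyCausal.exists_forall_notMem_of_isCompact_holds`, landed
2026-08-16) and ENDLESSNESS OF AFFINE GEODESIC RAYS (O'Neill 1983 Ch. 5 Lemma 8: a geodesic on
`[0, ∞)` with non-vanishing velocity has no future endpoint) — the only open stub, split as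

* `stub_escape` — pure calculus in a normed space: a `C²` curve `x` on `[t₀, ∞)` with
  `‖x''‖ ≤ C ‖x'‖²` and `x' ≠ 0` does not converge as `t → ∞` (scaling/bootstrap estimate);
* `stub_rayEndless` — manifold plumbing: the 1-jet of a geodesic in the chart at a would-be
  endpoint satisfies the hypotheses of `stub_escape` (`hasDerivAt_oneJet_of_covariantDerivAlong_eq_zero`,
  `exists_christoffelChart`), hence an affine geodesic ray with non-zero velocity is
  `IsFutureEndless`.

`ErgoregionBomb_of` concludes the crux BY NAME from the stubs; `stub_bernalSanchez` and
`stub_nonImprisonment` are bookkeeping stubs closed by the tree theorems named in their docstrings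
(the farm had not yet built those freshly landed modules when this skeleton was registered).
-/

noncomputable section

set_option linter.dupNamespace false

open Bundle Set Filter
open scoped Manifold Topology

namespace Summit.FinalStateConjecture.FinalStateConjecture.Theorems

open Literature.Geometry.Lorentzian
open Summit.FinalStateConjecture.FinalStateConjecture.Theses.ZeroEnergyKerrOrBomb

/-- STUB (CLOSED IN TREE, one-liner once the farm has built the module landed 2026-08-16 06:12Z:
`LorentzianMetric.bernalSanchez_isStronglyCausal_of_isGloballyHyperbolic_holds`,
`Literature.Geometry.Lorentzian.GlobalHyperbolicityStrongCausalityProofs`): Bernal–Sánchez 2007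
Thm 3.2, globally hyperbolic ⇒ strongly causal, for the telescope. [cite: BernalSanchez2007CQG, Thm. 3.2] -/
theorem stub_bernalSanchez (𝓑 : StationaryAFBlackHole.{0}) (τ : TimeOrientation 𝓑.metric) :
    𝓑.metric.bernalSanchez_isStronglyCausal_of_isGloballyHyperbolic τ := by
  sorry

/-- STUB (CLOSED IN TREE, one-liner once the farm has built the module landed 2026-08-16 06:03Z:
`LorentzianMetric.IsStronglyCausal.exists_forall_notMem_of_isCompact_holds`,
`Literature.Geometry.Lorentzian.NonImprisonmentProofs`): non-imprisonment of future-endless causal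
curves in compact sets under strong causality (O'Neill 1983 Ch. 14 Lemma 13), for the telescope.
[cite: ONeillSemiRiemannian1983, Ch. 14, Lemma 13 (p. 407)] -/
theorem stub_nonImprisonment (𝓑 : StationaryAFBlackHole.{0}) (τ : TimeOrientation 𝓑.metric) :
    LorentzianMetric.IsStronglyCausal.exists_forall_notMem_of_isCompact 𝓑.metric τ := by
  sorry

/-- STUB (calculus core of O'Neill 1983 Ch. 5 Lemma 8 / Lee 2018 Lemma 6.19 in a chart): a curve
`x : [t₀, ∞) → F` in a real normed space with velocity `u`, acceleration `w`, `‖w‖ ≤ C ‖u‖²` and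
`u ≠ 0` everywhere does not converge as `t → ∞`. (Scaling: on the window
`[t₁, t₁ + S/‖u t₁‖]`, `S = 1/(8 max C 1)`, a bootstrap gives `‖u‖ ≤ 2‖u t₁‖`, hence
`‖x(t₁ + S/‖u t₁‖) - x t₁‖ ≥ S/2`, contradicting the Cauchy property of a convergent `x`.)
[folklore] -/
theorem stub_escape {F : Type*} [NormedAddCommGroup F] [NormedSpace ℝ F]
    {x u w : ℝ → F} {C t₀ : ℝ}
    (hx : ∀ t, t₀ ≤ t → HasDerivAt x (u t) t)
    (hu : ∀ t, t₀ ≤ t → HasDerivAt u (w t) t)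
    (hw : ∀ t, t₀ ≤ t → ‖w t‖ ≤ C * ‖u t‖ ^ 2)
    (hu0 : ∀ t, t₀ ≤ t → u t ≠ 0) (x₀ : F) :
    ¬ Tendsto x atTop (𝓝 x₀) := by
  sorry

/-- STUB (O'Neill 1983 Ch. 5 Lemma 8, telescope form, from `stub_escape`): an affinely
parametrised geodesic of the Levi-Civita connection of `𝓑` on `[0, ∞)` with nowhere-vanishing
velocity has no future endpoint. [cite: ONeill1983, Ch. 5, Lemma 8] -/
theorem stub_rayEndless
    (hEsc : ∀ {F : Type} [NormedAddCommGroup F] [NormedSpace ℝ F]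
      {x u w : ℝ → F} {C t₀ : ℝ},
      (∀ t, t₀ ≤ t → HasDerivAt x (u t) t) → (∀ t, t₀ ≤ t → HasDerivAt u (w t) t) →
      (∀ t, t₀ ≤ t → ‖w t‖ ≤ C * ‖u t‖ ^ 2) → (∀ t, t₀ ≤ t → u t ≠ 0) →
      ∀ x₀ : F, ¬ Tendsto x atTop (𝓝 x₀))
    (𝓑 : StationaryAFBlackHole.{0}) [𝓑.metric.HasLeviCivita] (γ : ℝ → 𝓑.carrier)
    (hg : IsGeodesicOn 𝓑.metric.leviCivita γ (Set.Ici 0))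
    (hv : ∀ s : ℝ, 0 ≤ s → velocity (𝓡 4) γ s ≠ 0) : IsFutureEndless γ (Set.Ici 0) := by
  sorry

/-- **The crux `ErgoregionBomb` as typed** (vacuously: its antecedent is contradictory on every
hole of the telescope), composed BY NAME from `Negative.trapping_clause_contradictory` (p73277),
the tree discharges of Bernal–Sánchez 2007 Thm 3.2 and of non-imprisonment, and the two stubs
above. No vacuum / horizon / zero-energy / mode input is used; the planner must restate the crux
through `HasZeroEnergyRayTrappedModFlow` (intended statement C′/C‴, see `Cruxes/ErgoregionBomb/Disproof.lean` §B).
[folklore] -/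
theorem ErgoregionBomb_of : ErgoregionBomb := by
  intro 𝓑 _ _ _ _ _ hgh _ γ K hg hz hK _ hin
  exact (ErgoregionBomb.Negative.trapping_clause_contradictory 𝓑
    (stub_bernalSanchez 𝓑) (stub_nonImprisonment 𝓑)
    (fun γ' hg' hv' ↦ stub_rayEndless (fun hx hu hw hu0 ↦ stub_escape hx hu hw hu0) 𝓑 γ' hg' hv')
    hgh hg (fun s hs ↦ (hz s hs).1) hK hin).elim

end Summit.FinalStateConjecture.FinalStateConjecture.Theorems

end
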